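import Literature.NumberTheory.Automorphic.Liu2021.CheckOfChi
import Literature.NumberTheory.AdelicBaseChange.FiniteAdeleGaloisDescent
import Mathlib.NumberTheory.RamificationInertia.Valuation
import HarnessLib

/-!
# Hilbert 90 for the finite-adelic centre: `u ↦ u / uᶜ : (𝔸_E^∞)ˣ → U(1)(𝔸_{F,f})` is SURJECTIVE, with kernel the `c`-fixed idèles

Topic `NumberTheory/Automorphic/Liu2021`; namespace `Literature.NumberTheory.Automorphic.Liu2021` (the home of ★
`finAdelicCheck`, `CheckOfChi.lean`).  THEOREMS ONLY (no definition, no instance, no named fact, no `sorry`).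

SETTING.  `E/F` number fields, `c : E ≃ₐ[F] E` with `hcc : c * c = 1` and `hc : c ≠ 1` (so `E/F` is the quadratic extension
`E = F(c)`-fixed-by-`c`), `U(1)(𝔸_{F,f}) = UnitaryGroup.finAdelicOne F E c = {x ∈ (𝔸_E^∞)ˣ | (c ⊗ 1)(x) · x = 1}` the norm-one
finite idèles ([Mok2014, §1 p. 5]) and ★ `finAdelicCheck F E c hcc : (𝔸_E^∞)ˣ →* U(1)(𝔸_{F,f})`, `u ↦ u / uᶜ` ([Liu2021, App. D
§D.1], the map behind `χ̌(x) = χ(x/xᶜ)`).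

* §1 (one place) `exists_ne_zero_mul_galAdicCompletionMap_eq` — HILBERT 90 AT A `c`-FIXED PLACE `w` WITH INTEGRALITY: for
  `l ∈ E_w` with `l · c_*(l) = 1` there is `s ≠ 0` with `l · c_*(s) = s`, and `|s|_w = 1` as soon as `e(w | w ∩ 𝓞 F) = 1`
  (field H90 for the involution `c_*` of `E_w`, then rescaling by the image of a global uniformizer of `w ∩ 𝓞 F`, which `c_*`
  fixes and which is a uniformizer of `E_w` when `w` is unramified).
* §2 **`finAdelicCheck_surjective`** — every norm-one finite idèle `x` is `u / uᶜ`: at a split pair `{w, cw}` take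
  `(u_w, u_{cw}) = (1, x_{cw})`, at a `c`-fixed `w` the §1 witness; the family is a finite idèle by Mathlib
  `FiniteAdeleRing.isUnit_iff` (`E/F` is unramified at all but finitely many `w`, Dedekind's different theorem), and
  `u = x · (c ⊗ 1)(u)` is checked componentwise (`FiniteAdeleRing.smul_apply`).  Equivalently: the sequence
  `1 → (𝔸_{F,f})ˣ → (𝔸_{E,f})ˣ → U(1)(𝔸_{F,f}) → 1` is exact on the right (Hilbert 90 for the restricted product; Tate,
  Cassels–Fröhlich VII §7.3 with the local H90 of Ch. VI §1.7 / Serre, *Local Fields* X §1).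
* §3 KERNEL: `finAdelicCheck_eq_one_iff` (`u/uᶜ = 1 ↔ c • u = u`, definitional bookkeeping), `finAdelicCheck_eq_iff`
  (fibres are cosets of the `c`-fixed idèles) and, for `E/F` Galois of degree 2, `finAdelicCheck_eq_one_iff_mem_range`:
  the kernel is the conorm image of `(𝔸_{F,f})ˣ` (★ `AdelicBaseChange.mem_range_finiteIdeleConorm_iff`, Tate VII §7.3 (a)).

The DESCENT of characters through `finAdelicCheck` (existence/uniqueness, continuity by the open-mapping theorem, unitarity
and automorphy transfer) is the sequel `FinAdelicCheckDescent.lean`.  Cell `hodgecm-mathlib` FLOOR 0 programme P2, row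
«U1-DESCENT» (sub-line `Cruxes/H413/Lines/F0_P2PKPiRung4`, consumer `grdChi` of `F0P2iGRDWitness`);
`--supports stmt-HodgeConjecture-24833`; HC_CM is proved only modulo the printed citations until rung 0 closes, and this file is
idelic number theory asserting nothing about unitary groups in more than one variable.

## Mathlib / tree search

Mathlib: `FiniteAdeleRing.isUnit_iff`, `IsDedekindDomain.HeightOneSpectrum.valuation_liesOver` (RamificationInertia/Valuation),
`Ideal.ramificationIdx'_eq_ramificationIdx`, `Ideal.ramificationIdx_eq_one_of_isUnramifiedAt`, `not_dvd_differentIdeal_iff`,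
`valuation_exists_uniformizer`, `WithZero.exp/log`.  Tree: ★ `GaloisActionPlaces` (`galAdicCompletionMap_*`,
`valued_galAdicCompletionMap`), ★ `GaloisActionAdeleRing` (`FiniteAdeleRing.smul_apply`), ★ `Sweep1BaseChangeGLOne.
eventually_ramificationIdx_eq_one` (same 6-line different argument, re-proved privately here to keep the import cone small),
★ `CentralSimple.AntiInvolutionSecondKind.exists_ne_zero_mul_apply_eq` (field H90 for an involution; idem),
★ `AdelicBaseChange.FiniteAdeleGaloisDescent.mem_range_finiteIdeleConorm_iff`.  Nothing in the tree proved the surjectivity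
(`rg finAdelicCheck`: six consumer files of the definition).

## References
* [CasselsFrohlichANT1967] J. W. S. Cassels, A. Fröhlich (eds.), *Algebraic Number Theory* (1967): Ch. VI (Atiyah–Wall) §1.7
  / Ch. V (Serre) §2.7 Prop. 5 (Hilbert 90); Ch. VII (Tate) §7.3 Prop. (a) (`J_K ≃ J_L^G`).
* [NeukirchANT1999] J. Neukirch, *Algebraic Number Theory* (1999), Ch. III Thm. (2.6) (the different and ramification).
* [Mok2014] C. P. Mok, Mem. AMS 235 (2015), §1 Notation p. 5 (`U_{E/F}(1)`).
* [Liu2021] Y. Liu, *Fourier–Jacobi cycles and arithmetic relative trace formula*, Camb. J. Math. 9 (2021), App. D §D.1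
  (`χ̌(x) = χ(x/xᶜ)`).
-/

set_option autoImplicit false

noncomputable section

open NumberField IsDedekindDomain
open scoped WithZero

namespace Literature.NumberTheory.Automorphic.Liu2021

open Literature.NumberTheory.Automorphic.UnitaryGroup
open Literature.NumberTheory.AdelicBaseChange

section Generic

variable (F E : Type) [Field F] [NumberField F] [Field E] [NumberField E] [Algebra F E] (c : E ≃ₐ[F] E)

/-! ## §0 Two Mathlib-only helpers (private copies of tree lemmas, to keep the import cone small) -/

omit [NumberField F] in
/-- Hilbert's Satz 90 for an involution of a field: `σ² = id`, `σ ≠ id`, `l · σ l = 1 ⇒ ∃ b ≠ 0, l · σ b = b`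
(`b = 1 + l`, or `b = a − σ a` with `σ a ≠ a` when `l = −1`).  Private copy of ★
`CentralSimple.AntiInvolutionSecondKind.exists_ne_zero_mul_apply_eq`. [cite: CasselsFrohlichANT1967, Ch. V §2.7 Prop. 5] -/
private theorem exists_ne_zero_mul_apply_eq' {K : Type*} [Field K] (σ : K →+* K) (hσ : ∀ a, σ (σ a) = a)
    (hσ1 : ∃ a, σ a ≠ a) {l : K} (hl : l * σ l = 1) : ∃ b : K, b ≠ 0 ∧ l * σ b = b := by
  by_cases hl1 : l = -1
  · subst hl1
    obtain ⟨a, ha⟩ := hσ1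
    refine ⟨a - σ a, sub_ne_zero.2 (Ne.symm ha), ?_⟩
    rw [map_sub, hσ, neg_one_mul, neg_sub]
  · refine ⟨1 + l, fun h => hl1 (by linear_combination h), ?_⟩
    rw [map_add, map_one, mul_add, mul_one, hl, add_comm]

/-- `E/F` is unramified at all but finitely many places: `e(w | w ∩ 𝓞 F) = 1` for every `w` not dividing the (non-zero)
relative different.  Private copy of ★ `Automorphic.eventually_ramificationIdx_eq_one` (`Sweep1BaseChangeGLOne`).
[cite: NeukirchANT1999, Ch. III Thm. (2.6)] -/
private theorem eventually_ramificationIdx_eq_one' :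
    ∀ᶠ w : HeightOneSpectrum (𝓞 E) in Filter.cofinite, w.asIdeal.ramificationIdx (𝓞 F) = 1 := by
  have h0 : differentIdeal (𝓞 F) (𝓞 E) ≠ ⊥ := differentIdeal_ne_bot
  refine (Ideal.finite_factors h0).subset fun w hw => ?_
  by_contra hnd
  apply hw
  haveI : Algebra.IsUnramifiedAt (𝓞 F) w.asIdeal := not_dvd_differentIdeal_iff.mp hnd
  exact Ideal.ramificationIdx_eq_one_of_isUnramifiedAt

omit [NumberField F] [Algebra F E] in
/-- Components of a product of finite adèles (definitional). [folklore] -/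
private theorem finiteAdele_mul_apply' (a b : FiniteAdeleRing (𝓞 E) E) (w : HeightOneSpectrum (𝓞 E)) :
    (a * b) w = a w * b w := rfl

omit [NumberField F] [Algebra F E] in
/-- Components of `1` (definitional). [folklore] -/
private theorem finiteAdele_one_apply' (w : HeightOneSpectrum (𝓞 E)) : (1 : FiniteAdeleRing (𝓞 E) E) w = 1 := rfl

/-! ## §1 Hilbert 90 at one `c`-fixed place, with integrality at the unramified ones -/

omit [NumberField F] in
/-- `c_*` is an involution of `E_w` at a `c`-fixed place `w` (`c² = 1`, cocycle law of the Galois transport `σ_{τw} ∘ τ_w = (στ)_w`).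
[cite: CasselsFrohlichANT1967, Ch. VII §1.1] -/
theorem galAdicCompletionMap_galAdicCompletionMap_self (hcc : c * c = 1) {w : HeightOneSpectrum (𝓞 E)} (hw : c • w = w)
    (y : w.adicCompletion E) : galAdicCompletionMap (L := E) c hw (galAdicCompletionMap (L := E) c hw y) = y := by
  rw [galAdicCompletionMap_galAdicCompletionMap E c c hw hw,
    galAdicCompletionMap_congr_left E hcc _ (one_smul (E ≃ₐ[F] E) w), galAdicCompletionMap_one]

omit [NumberField F] in
/-- At a `c`-fixed place, `c_*` is NOT the identity of `E_w` as soon as `c ≠ 1` (it moves the image of any `e ∈ E` with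
`c e ≠ e`, `E → E_w` being injective): the decomposition group at `w` acts faithfully on `E_w`.
[cite: CasselsFrohlichANT1967, Ch. VII §1.1] -/
theorem exists_galAdicCompletionMap_ne (hc : c ≠ 1) {w : HeightOneSpectrum (𝓞 E)} (hw : c • w = w) :
    ∃ a : w.adicCompletion E, galAdicCompletionMap (L := E) c hw a ≠ a := by
  obtain ⟨e, he⟩ : ∃ e : E, c e ≠ e := by
    by_contra h
    push Not at h
    exact hc (AlgEquiv.ext h)
  refine ⟨(e : w.adicCompletion E), fun h => he ?_⟩
  rw [galAdicCompletionMap_coe_algEquiv F c hw e] at h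
  exact (algebraMap E (w.adicCompletion E)).injective h

/-- **Hilbert 90 at a `c`-fixed place `w`, with integrality.**  If `l ∈ E_w` satisfies `l · c_*(l) = 1` then
`l · c_*(s) = s` for some `s ≠ 0`, and `s` can be taken of absolute value `1` whenever `e(w | w ∩ 𝓞 F) = 1`:
field H90 for the involution `c_*` gives some `b ≠ 0`; the image `p` in `E_w` of a global uniformizer `ϖ` of
`v = w ∩ 𝓞 F` is `c_*`-fixed (`galAdicCompletionMap_algebraMap`) and has `|p|_w = |ϖ|_v ^ e(w|v)` (Mathlib
`valuation_liesOver`), so `s := b · p ^ (ord_w b)` works. [cite: CasselsFrohlichANT1967, Ch. VI §1.7; Ch. V §2.7 Prop. 5] -/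
theorem exists_ne_zero_mul_galAdicCompletionMap_eq (hcc : c * c = 1) (hc : c ≠ 1) {w : HeightOneSpectrum (𝓞 E)}
    (hw : c • w = w) {l : w.adicCompletion E} (hl : l * galAdicCompletionMap (L := E) c hw l = 1) :
    ∃ s : w.adicCompletion E, s ≠ 0 ∧ l * galAdicCompletionMap (L := E) c hw s = s ∧
      (w.asIdeal.ramificationIdx (𝓞 F) = 1 → Valued.v s = 1) := by
  -- field H90 for the involution `τ = c_*`
  obtain ⟨b, hb0, hb⟩ := exists_ne_zero_mul_apply_eq' (galAdicCompletionMap (L := E) c hw)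
    (galAdicCompletionMap_galAdicCompletionMap_self F E c hcc hw) (exists_galAdicCompletionMap_ne F E c hc hw) hl
  -- a global uniformizer of `v = w ∩ 𝓞 F`, seen in `E_w`
  set v : HeightOneSpectrum (𝓞 F) := w.under (𝓞 F) with hv
  obtain ⟨ϖ, hϖ⟩ := v.valuation_exists_uniformizer F
  set p : w.adicCompletion E := ((algebraMap F E ϖ : E) : w.adicCompletion E) with hp
  have hτp : galAdicCompletionMap (L := E) c hw p = p := galAdicCompletionMap_algebraMap F c hw ϖ
  haveI : w.asIdeal.LiesOver v.asIdeal := ⟨rfl⟩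
  have hvp : Valued.v p = WithZero.exp (-1 : ℤ) ^ v.asIdeal.ramificationIdx' w.asIdeal := by
    rw [hp, HeightOneSpectrum.valuedAdicCompletion_eq_valuation', ← IsDedekindDomain.HeightOneSpectrum.valuation_liesOver E v w ϖ, hϖ]
  have hp0 : p ≠ 0 := by
    intro h
    rw [h, map_zero] at hvp
    exact pow_ne_zero _ WithZero.exp_ne_zero hvp.symm
  -- the witness
  set m : ℤ := WithZero.log (Valued.v b) with hm
  have hvb : Valued.v b = WithZero.exp m := by
    rw [hm, WithZero.exp_log ((Valuation.ne_zero_iff _).2 hb0)]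
  refine ⟨b * p ^ m, mul_ne_zero hb0 (zpow_ne_zero m hp0), ?_, fun he => ?_⟩
  · rw [map_mul, map_zpow₀, hτp, ← mul_assoc, hb]
  · have he' : v.asIdeal.ramificationIdx' w.asIdeal = 1 := by
      rw [Ideal.ramificationIdx'_eq_ramificationIdx _ _ v.ne_bot]; exact he
    rw [map_mul, map_zpow₀, hvb, hvp, he', pow_one, ← WithZero.exp_zsmul, smul_neg, zsmul_one, Int.cast_id,
      ← WithZero.exp_add, add_neg_cancel, WithZero.exp_zero]

/-! ## §2 Surjectivity of `u ↦ u / uᶜ` -/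

omit [NumberField F] in
/-- Componentwise form of the norm-one condition: `c_*(x_{c⁻¹ w}) · x_w = 1` in every `E_w`. [cite: Mok2014, §1 Notation p. 5] -/
theorem galAdicCompletionMap_apply_mul_apply_eq_one_of_mem {x : (FiniteAdeleRing (𝓞 E) E)ˣ} (hx : x ∈ finAdelicOne F E c)
    (w : HeightOneSpectrum (𝓞 E)) :
    galAdicCompletionMap (L := E) c (smul_inv_smul c w) ((x : FiniteAdeleRing (𝓞 E) E) (c⁻¹ • w)) *
      (x : FiniteAdeleRing (𝓞 E) E) w = 1 := by
  have h := congrArg (fun a : FiniteAdeleRing (𝓞 E) E => a w) ((mem_finAdelicOne_iff F E c x).1 hx)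
  rwa [conjFiniteAdele_apply, finiteAdele_mul_apply', finiteAdele_one_apply', FiniteAdeleRing.smul_apply] at h

omit [NumberField F] in
/-- At a `c`-fixed place the norm-one condition reads `x_w · c_*(x_w) = 1`. [cite: Mok2014, §1 Notation p. 5] -/
theorem apply_mul_galAdicCompletionMap_apply_eq_one_of_mem {x : (FiniteAdeleRing (𝓞 E) E)ˣ} (hx : x ∈ finAdelicOne F E c)
    {w : HeightOneSpectrum (𝓞 E)} (hw : c • w = w) :
    (x : FiniteAdeleRing (𝓞 E) E) w * galAdicCompletionMap (L := E) c hw ((x : FiniteAdeleRing (𝓞 E) E) w) = 1 := by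
  have h := galAdicCompletionMap_apply_mul_apply_eq_one_of_mem F E c hx w
  rwa [galAdicCompletionMap_apply_congr_place E (inv_smul_eq_of_smul_eq hw) (smul_inv_smul c w) hw
    (⇑(x : FiniteAdeleRing (𝓞 E) E)), mul_comm] at h

/-- **Hilbert 90 for the finite-adelic centre: `u ↦ u / uᶜ : (𝔸_E^∞)ˣ → U(1)(𝔸_{F,f})` is surjective** (`c` an involution
`≠ 1` of `E` over `F`).  For a norm-one finite idèle `x` choose, in each `c`-orbit of finite places of `E`, the components
`(u_w, u_{cw}) = (1, x_{cw})` at a split pair and the §1 witness `u_w` (with `x_w · c_*(u_w) = u_w`) at a fixed place; the family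
`u` is a unit of `𝔸_E^∞` (non-zero everywhere; of absolute value one wherever `x_w` is a unit and `E/F` is unramified, i.e. at
all but finitely many `w`) and `u = x · (c ⊗ 1)(u)`, i.e. `u / uᶜ = x`.  (Right exactness of
`(𝔸_{F,f})ˣ → (𝔸_{E,f})ˣ → U(1)(𝔸_{F,f})`; Tate, Cassels–Fröhlich VII §7.3 with local Hilbert 90.)
[cite: CasselsFrohlichANT1967, Ch. VII §7.3; Ch. VI §1.7] -/
theorem finAdelicCheck_surjective (hcc : c * c = 1) (hc : c ≠ 1) : Function.Surjective (finAdelicCheck F E c hcc) := by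
  classical
  rintro ⟨x, hx⟩
  have hcinv : c⁻¹ = c := inv_eq_of_mul_eq_one_right hcc
  -- a representative in each `c`-orbit of places
  obtain ⟨rep, hrep, hrepc⟩ : ∃ rep : HeightOneSpectrum (𝓞 E) → HeightOneSpectrum (𝓞 E),
      (∀ w, rep w = w ∨ rep w = c • w) ∧ ∀ w, rep (c • w) = rep w := by
    refine ⟨fun w => @Classical.epsilon _ ⟨w⟩ (fun u => u = w ∨ u = c • w), fun w =>
      Classical.epsilon_spec (p := fun u => u = w ∨ u = c • w) ⟨w, Or.inl rfl⟩, fun w => ?_⟩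
    have hfun : (fun u : HeightOneSpectrum (𝓞 E) => u = c • w ∨ u = c • c • w) = fun u => u = w ∨ u = c • w := by
      funext u; rw [smul_smul, hcc, one_smul]; exact propext or_comm
    simp only [hfun]
  -- local witnesses at the fixed places
  have hloc : ∀ w : {w : HeightOneSpectrum (𝓞 E) // c • w = w}, ∃ s : w.1.adicCompletion E, s ≠ 0 ∧
      (x : FiniteAdeleRing (𝓞 E) E) w.1 * galAdicCompletionMap (L := E) c w.2 s = s ∧
        (w.1.asIdeal.ramificationIdx (𝓞 F) = 1 → Valued.v s = 1) := fun w =>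
    exists_ne_zero_mul_galAdicCompletionMap_eq F E c hcc hc w.2 (apply_mul_galAdicCompletionMap_apply_eq_one_of_mem F E c hx w.2)
  choose s hs0 hs hsv using hloc
  -- the components of `u`
  let f : ∀ w : HeightOneSpectrum (𝓞 E), w.adicCompletion E := fun w =>
    if hw : c • w = w then s ⟨w, hw⟩ else if rep w = w then 1 else (x : FiniteAdeleRing (𝓞 E) E) w
  have hxu := FiniteAdeleRing.isUnit_iff.1 x.isUnit
  -- `|f w| = 1` for almost all `w`
  have hf1 : ∀ᶠ w in Filter.cofinite, Valued.v (f w) = 1 := by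
    filter_upwards [hxu.2, eventually_ramificationIdx_eq_one' F E] with w hxw hew
    by_cases hw : c • w = w
    · simp only [f, dif_pos hw]; exact hsv ⟨w, hw⟩ hew
    · by_cases hr : rep w = w
      · simp only [f, dif_neg hw, if_pos hr, map_one]
      · simp only [f, dif_neg hw, if_neg hr]; exact hxw
  have hfint : ∀ᶠ w in Filter.cofinite, f w ∈ w.adicCompletionIntegers E := by
    filter_upwards [hf1] with w hw
    rw [HeightOneSpectrum.mem_adicCompletionIntegers, hw]
  let a : FiniteAdeleRing (𝓞 E) E := ⟨f, hfint⟩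
  have ha : ∀ w, a w = f w := fun _ => rfl
  have hf0 : ∀ w, f w ≠ 0 := by
    intro w
    by_cases hw : c • w = w
    · simp only [f, dif_pos hw]; exact hs0 ⟨w, hw⟩
    · by_cases hr : rep w = w
      · simp only [f, dif_neg hw, if_pos hr]; exact one_ne_zero
      · simp only [f, dif_neg hw, if_neg hr]; exact hxu.1 w
  have hau : IsUnit a := FiniteAdeleRing.isUnit_iff.2 ⟨fun w => hf0 w, hf1⟩
  -- `a = x · (c ⊗ 1)(a)`, place by place
  have key : a = (x : FiniteAdeleRing (𝓞 E) E) * (c • a) := by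
    refine FiniteAdeleRing.ext E fun w => ?_
    rw [finiteAdele_mul_apply', FiniteAdeleRing.smul_apply]
    simp only [ha]
    by_cases hw : c • w = w
    · -- fixed place: the §1 witness
      rw [galAdicCompletionMap_apply_congr_place E (inv_smul_eq_of_smul_eq hw) (smul_inv_smul c w) hw f]
      simp only [f, dif_pos hw]
      exact (hs ⟨w, hw⟩).symm
    · -- split pair `{w, c w}`
      have hw' : ¬ c • (c⁻¹ • w) = c⁻¹ • w := by rwa [smul_inv_smul, eq_comm, hcinv]
      have hrw' : rep (c⁻¹ • w) = rep w := by rw [hcinv, hrepc]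
      by_cases hr : rep w = w
      · have hr' : ¬ rep (c⁻¹ • w) = c⁻¹ • w := by
          rw [hrw', hr, hcinv]; exact fun h => hw (h.symm)
        simp only [f, dif_neg hw, if_pos hr, dif_neg hw', if_neg hr']
        rw [mul_comm]
        exact (galAdicCompletionMap_apply_mul_apply_eq_one_of_mem F E c hx w).symm
      · have hr2 : rep w = c • w := (hrep w).resolve_left hr
        have hr' : rep (c⁻¹ • w) = c⁻¹ • w := by rw [hrw', hr2, hcinv]
        simp only [f, dif_neg hw, if_neg hr, dif_neg hw', if_pos hr', map_one, mul_one]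
  -- conclude
  refine ⟨hau.unit, Subtype.ext ?_⟩
  rw [coe_finAdelicCheck, div_eq_iff_eq_mul, Units.ext_iff, Units.val_mul]
  exact key

/-- Existential form of `finAdelicCheck_surjective`: every norm-one finite idèle is `u / uᶜ`. [cite: CasselsFrohlichANT1967, Ch. VII §7.3] -/
theorem exists_finAdelicCheck_eq (hcc : c * c = 1) (hc : c ≠ 1) (x : finAdelicOne F E c) :
    ∃ u : (FiniteAdeleRing (𝓞 E) E)ˣ, finAdelicCheck F E c hcc u = x :=
  finAdelicCheck_surjective F E c hcc hc x

/-! ## §3 The kernel: `c`-fixed finite idèles (= conorms from `F` when `E/F` is quadratic Galois) -/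

omit [NumberField F] in
/-- `u / uᶜ = 1 ↔ (c ⊗ 1) u = u`. [cite: CasselsFrohlichANT1967, Ch. VII §7.3] -/
theorem finAdelicCheck_eq_one_iff (hcc : c * c = 1) (u : (FiniteAdeleRing (𝓞 E) E)ˣ) :
    finAdelicCheck F E c hcc u = 1 ↔ c • (u : FiniteAdeleRing (𝓞 E) E) = u := by
  rw [← Subtype.coe_inj, coe_finAdelicCheck, OneMemClass.coe_one, div_eq_one, eq_comm, Units.ext_iff]
  rfl

omit [NumberField F] in
/-- Fibres of `u ↦ u / uᶜ` are cosets of the `c`-fixed idèles: `u/uᶜ = u'/u'ᶜ ↔ (c ⊗ 1)(u/u') = u/u'`.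
[cite: CasselsFrohlichANT1967, Ch. VII §7.3] -/
theorem finAdelicCheck_eq_iff (hcc : c * c = 1) (u u' : (FiniteAdeleRing (𝓞 E) E)ˣ) :
    finAdelicCheck F E c hcc u = finAdelicCheck F E c hcc u' ↔
      c • ((u / u' : (FiniteAdeleRing (𝓞 E) E)ˣ) : FiniteAdeleRing (𝓞 E) E) = (u / u' : (FiniteAdeleRing (𝓞 E) E)ˣ) := by
  rw [← finAdelicCheck_eq_one_iff F E c hcc, map_div, div_eq_one]

omit [NumberField F] [NumberField E] in
/-- In a quadratic extension with non-trivial automorphism `c`, every `F`-automorphism is `1` or `c`. [folklore] -/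
private theorem algEquiv_eq_one_or_eq_of_finrank_eq_two (h2 : Module.finrank F E = 2) (hc : c ≠ 1) (σ : E ≃ₐ[F] E) :
    σ = 1 ∨ σ = c := by
  classical
  haveI : FiniteDimensional F E := Module.finite_of_finrank_eq_succ h2
  by_contra h
  push Not at h
  have hlt : 2 < Fintype.card (E ≃ₐ[F] E) :=
    Fintype.two_lt_card_iff.2 ⟨σ, 1, c, h.1, h.2, hc.symm⟩
  have hle : Fintype.card (E ≃ₐ[F] E) ≤ Module.finrank F E := AlgEquiv.card_le
  omega

/-- **The kernel of `u ↦ u/uᶜ` is the conorm image of `(𝔸_{F,f})ˣ`** when `E/F` is Galois of degree `2`: a finite idèle of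
`E` fixed by `c` is fixed by `Gal(E/F) = {1, c}`, hence comes from `F` (★ `mem_range_finiteIdeleConorm_iff`, Tate VII §7.3 (a)
«`J_K ≃ J_L^G`», finite part). [cite: CasselsFrohlichANT1967, Ch. VII §7.3 Prop. (a)] -/
theorem finAdelicCheck_eq_one_iff_mem_range [IsGalois F E] (h2 : Module.finrank F E = 2) (hcc : c * c = 1) (hc : c ≠ 1)
    (u : (FiniteAdeleRing (𝓞 E) E)ˣ) :
    finAdelicCheck F E c hcc u = 1 ↔ u ∈ Set.range (finiteIdeleConorm F E) := by
  rw [finAdelicCheck_eq_one_iff, mem_range_finiteIdeleConorm_iff]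
  constructor
  · intro h σ
    rcases algEquiv_eq_one_or_eq_of_finrank_eq_two F E c h2 hc σ with rfl | rfl
    · exact one_smul _ _
    · exact h
  · intro h
    exact h c

/-- The conorm image is killed: `con(b) / con(b)ᶜ = 1` for every finite idèle `b` of `F` (no Galois hypothesis).
[cite: CasselsFrohlichANT1967, Ch. VII §7.3 Prop. (a)] -/
theorem finAdelicCheck_finiteIdeleConorm (hcc : c * c = 1) (b : (FiniteAdeleRing (𝓞 F) F)ˣ) :
    finAdelicCheck F E c hcc (finiteIdeleConorm F E b) = 1 := by
  rw [finAdelicCheck_eq_one_iff]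
  exact smul_coe_finiteIdeleConorm F E c b

end Generic

end Literature.NumberTheory.Automorphic.Liu2021

end
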